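import Mathlib
import HarnessLib
import HarnessLib.Audit
import Summits.MatrixMultiplication.Statement
import Literature.Computability.AlgebraicComplexity.SchoenhageTau
import Literature.Computability.AlgebraicComplexity.GroupAlgebraTensor
import Literature.Computability.AlgebraicComplexity.AsymptoticSpectrum
import Literature.Computability.AlgebraicComplexity.SchoenhageTauBini
import Literature.Computability.AlgebraicComplexity.BorderRankRestriction
import Literature.Computability.AlgebraicComplexity.FlatteningBound
import HarnessLib.Audit.Status.Attr

/-!
Route: OrbitHarmonicsHosts

DORMANT since 2026-08-22T04:25:32Z (reconciler: no traction for 5.1 d (last activity item-evidence-added at 2026-08-17T02:21:36Z); parked, not closed — `ledger route dormant route-MatrixMultiplication-OrbitHarmonicsHosts --off` to react) — unstaffed, not closed; items shared with open routes are served there. `ledger route dormant <id> --off` reactivates.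

# Route OrbitHarmonicsHosts — equivariant matrix multiplication inside orbit-harmonics rings (cup
product of flag varieties with S_m-symmetry)

X_OH = EquivariantOrbitHosting ("it suffices to show"): for every ε > 0 there are a finite group Γ
with a representation ρ_V : Γ → GL_d(ℂ), a point v with FREE orbit P = Γ·v, an N ≥ 2 with |Γ| ≤
N^(2+ε), representations ρ_P, ρ_Q, ρ_R : Γ → GL_N(ℂ) and Γ-EQUIVARIANT linear maps α, β : M_N(ℂ) →
ℂ[x_1..x_d], γ : ℂ[x] → M_N(ℂ) with γ ≡ 0 on LF(I(P)) (top-degree forms of the vanishing ideal) and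
γ(α(X)·β(Y)) = X·Y for all X, Y — i.e. ⟨N,N,N⟩ is a Γ-equivariant restriction of the structure
tensor of the ORBIT-HARMONICS RING gr(P) = ℂ[x]/LF(I(P)) (commutative, graded, a flat limit of
Fun(P) ≅ ℂ^|Γ|, regular Γ-module; for Γ = S_m on ℂ^m it is H^*(Fl_m) = ℂ[x]/(e_1..e_m)). Realises
card orbit-harmonics-hosts, SHARPENED: its non-equivariant thesis is shown vacuous (⇔ ω = 2) and
abelian Γ are shown empty, so the target is the equivariant, non-abelian form ("Cohn–Umans inside
the associated graded pointwise algebra of the group instead of its group algebra").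
Lean: `∀ ε : ℝ, 0 < ε → ∃ (Γ : Type) (_ : Group Γ) (_ : Fintype Γ) (d N : ℕ) (ρV : Γ →* GL (Fin d)
ℂ) (v : Fin d → ℂ) (ρP ρQ ρR : Γ →* GL (Fin N) ℂ) (α β : Matrix (Fin N) (Fin N) ℂ →ₗ[ℂ] MvPolynomial
(Fin d) ℂ) (γ : MvPolynomial (Fin d) ℂ →ₗ[ℂ] Matrix (Fin N) (Fin N) ℂ), 2 ≤ N ∧ (Fintype.card Γ : ℝ)
≤ (N : ℝ) ^ (2 + ε) ∧ Function.Injective (fun g : Γ => (ρV g : Matrix (Fin d) (Fin d) ℂ).mulVec v) ∧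
(∀ f ∈ Ideal.span ((fun f : MvPolynomial (Fin d) ℂ => MvPolynomial.homogeneousComponent
f.totalDegree f) '' ((MvPolynomial.vanishingIdeal ℂ (Set.range fun g : Γ => (ρV g : Matrix (Fin d)
(Fin d) ℂ).mulVec v) : Ideal (MvPolynomial (Fin d) ℂ)) : Set (MvPolynomial (Fin d) ℂ))), γ f = 0) ∧
(∀ X Y, γ (α X * β Y) = X * Y) ∧ (∀ (g : Γ) (X : Matrix (Fin N) (Fin N) ℂ), α ((ρP g⁻¹ : Matrix (Fin
N) (Fin N) ℂ) * X * (ρQ g : Matrix (Fin N) (Fin N) ℂ)) = MvPolynomial.aeval (fun i : Fin d => ∑ j :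
Fin d, (ρV g : Matrix (Fin d) (Fin d) ℂ) i j • (MvPolynomial.X j : MvPolynomial (Fin d) ℂ)) (α X)) ∧
(∀ (g : Γ) (Y : Matrix (Fin N) (Fin N) ℂ), β ((ρQ g⁻¹ : Matrix (Fin N) (Fin N) ℂ) * Y * (ρR g :
Matrix (Fin N) (Fin N) ℂ)) = MvPolynomial.aeval (fun i : Fin d => ∑ j : Fin d, (ρV g : Matrix (Fin
d) (Fin d) ℂ) i j • (MvPolynomial.X j : MvPolynomial (Fin d) ℂ)) (β Y)) ∧ (∀ (g : Γ) (f :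
MvPolynomial (Fin d) ℂ), γ (MvPolynomial.aeval (fun i : Fin d => ∑ j : Fin d, (ρV g : Matrix (Fin d)
(Fin d) ℂ) i j • (MvPolynomial.X j : MvPolynomial (Fin d) ℂ)) (f)) = (ρP g⁻¹ : Matrix (Fin N) (Fin
N) ℂ) * γ f * (ρR g : Matrix (Fin N) (Fin N) ℂ))`

## Assembly
Forget the equivariance: from X_OH at ε take (Γ, v, N, α, β, γ); push α, β, γ down to A =
ℂ[x]/LF(I(P)) (γ kills the ideal), apply HostingRestriction with the basis of ReesBound to get
TensorRestrictsTo (structureTensor b) ⟨N,N,N⟩, hence algBorderRank ⟨N,N,N⟩ ≤ algBorderRank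
(structureTensor b) ≤ |P| = |Γ| ≤ N^(2+ε) (TensorRestrictsTo.algBorderRank_le, ReesBound, free
orbit), hence ω(ℂ) ≤ log_N |Γ| ≤ 2 + ε by Bini (Blaser2013_thm66_holds.cubic, N ≥ 2); for all ε > 0
this is ω(ℂ) ≤ 2, i.e. MatrixMultiplication (matrixMultiplication_iff_omega_le_two). Standard
reductions only; the two support items carry the algebra.

Rationale: WHY THIS LINE. All border-rank savings live on the boundary of the orbit of ⟨r⟩, and the commutative
boundary points with large symmetry are exactly the orbit-harmonics rings gr(Γ·v) (CW_q = gr of q+2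
points of A^q, ℂ[x]/(x^M) = gr μ_M, H^*(Fl_m) = gr of a regular S_m-orbit: Kostant,
GarsiaProcesi1992; smoothable ⇒ minimal border rank, BlaserLysikov2016). The planner proves two
structural facts that pin down where content can live: (VACUITY) single-shot non-equivariant hosting
in these hosts at the o(1) level is EQUIVALENT to ω = 2, because Behrend 3-AP-free sets inside the
Artin monomial box give the hosts subrank (dim)^(1−o(1)) (so ω = 2 ⇒ ⟨N,N,N⟩ ≤ ⟨N^(2+ε)⟩ ≤ T_host),
and (ABELIAN NO-GO) abelian Γ force N³ ≤ |Γ| by an injectivity argument on (s,t,u) ↦ p_s − r_u +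
q_t, exactly as for abelian TPP (CohnUmans2003). What is left — and not implied by ω = 2 as far as
searched — is NON-ABELIAN EQUIVARIANT hosting, the analogue of Cohn–Umans with the group algebra
ℂ[G] replaced by the minimal-border-rank commutative algebra gr Fun(Γ) carrying the same regular
module; nearest relatives are symmetric rank decompositions (GrochowMoore2016, Burichenko2022:
semisimple host ℂ^r) and Lie-group TPP with degree-filtered representative functions
(BlasiakCohnGrochowPrattUmans2024: convolution host). Imported areas: algebraic combinatorics of
coinvariant/orbit-harmonics rings and Schubert calculus (the host), additive combinatorics (Behrend,
for the vacuity theorem), representation theory of finite groups (Wigner–Eckart reduction of the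
equivariant system: 3N² unknowns vs |Γ|⁻¹Σ|χ_Pχ_Qχ_R|² ≈ N^(4−o(1)) equations, the same
overdetermination as unrestricted fast matrix multiplication). No prior route or negative (index
empty) touches smoothable hosts or symmetric algorithms.

RANKED CRUXES. #0 EquivariantOrbitHosting (target) — X_OH as in § Thesis (general finite Γ, free
orbit, equivariant hosting with |Γ| ≤ N^(2+ε) for every ε > 0). (why it might fail: commutativity +
grading + Wigner–Eckart may force N^(2+c) ≤ |Γ| for all Γ (UniformObstruction); no instance beating
even the abelian bound N³ ≤ |Γ| is known.) [BlaserLysikov2016, GarsiaProcesi1992, CohnUmans2003,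
GrochowMoore2016]
#2 FlagHosting (crux) — the flag family realises X_OH: for every ε > 0 some coinvariant ring
H^*(Fl_m) = gr(S_m·(0,1,…,m−1)) hosts ⟨N,N,N⟩ S_m-equivariantly (ρ_P, ρ_Q, ρ_R : S_m → GL_N, α, β, γ
intertwining rename σ) with m! ≤ N^(2+ε) (card orbit-harmonics-hosts "flag-cohomology conjecture";
d_max(S_m) = (m!)^(1/2−o(1)) makes the count possible). [difficulty: open-problem] (why it might
fail: Wigner–Eckart reduces it to reduced cup-product maps between fake-degree multiplicity spaces
M_λ ⊗ M_μ → M_ν of H^*(Fl_m), which may have far too little rank; nothing is known even at m = 4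
(⟨3,3,3⟩, 27 unknowns / 31 equations).) [GarsiaProcesi1992, BlaserLysikov2016, CohnUmans2003,
Burichenko2022]
#3 BeatAbelianBound (crux) — SOME finite Γ (necessarily non-abelian, by AbelianNoGo) hosts ⟨N,N,N⟩
equivariantly in gr(Γ·v) with N³ > |Γ| — the analogue of the first Cohn–Umans groups beating the
trivial bound; necessary for X_OH (ε < 1); a finite search: N = 3 needs |Γ| ∈ [17,26] (bR(M_3) ≥
17), e.g. S_4 ↷ ℂ³ (host H^*(Fl_4), Hilbert series 1,3,5,6,5,3,1) or SL(2,3) ↷ ℂ²; N = 4 needs |Γ| ∈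
[29,63] (GL(2,3), A_5 ⊂ SO_3, …). [difficulty: M] (why it might fail: the S_4 / order-≤26 systems
(e.g. 27 unknowns vs 31 invariant trilinear equations for S_4, std⊗std⊗std) may all be infeasible;
commutativity may force N³ ≤ |Γ| for every Γ, not only abelian ones.) [CohnUmans2003,
ConnerHarperLandsberg2023, Smirnov2013, GrochowMoore2016]
#4 UniformObstruction (crux) — NEGATIVE side, refuter-facing: there is c > 0 (and C) such that every
Γ-equivariant hosting of ⟨N,N,N⟩ in an orbit-harmonics ring gr(Γ·v) (free orbit) has N^(2+c) ≤
C·|Γ|; proving it refutes EquivariantOrbitHosting and closes the route. Natural tools: gr = ⊕ V_λ ⊗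
M_λ with M_λ graded by fake degrees, gr(P)^Γ = ℂ (transitivity), socle/degree filtration, the
abelian injectivity argument. [difficulty: L] (why it might fail: non-abelian Γ with d_λ =
|Γ|^(1/2−o(1)) (S_m, GL_2(F_q)) may genuinely host at N = |Γ|^(1/2−o(1)); the gap may exist but be
non-uniform in Γ.) [CohnUmans2003, BlaserLysikov2020, BlasiakCohnGrochowPrattUmans2023]
#9 AbelianNoGo (support) — abelian symmetry gives nothing: for commutative Γ every equivariant
hosting in gr(Γ·v) has N³ ≤ |Γ|. Proof sketch: gr ≅ regular module with 1-dim weight spaces f_χ in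
single degrees ℓ(χ), f_χ f_ψ ≠ 0 iff ℓ(χ+ψ) = ℓ(χ)+ℓ(ψ); equivariance makes α, β, γ monomial (X_st ↦
f_(p_s−q_t), …); matched products nonzero ⇒ levels a(s,t)+b(t,u) = c(s,u) ⇒ a = a₀(s)+θ(t), b =
b₀(u)−θ(t); a collision of Ψ(s,t,u) = p_s − r_u + q_t with t ≠ t' is a cross term read twice with
opposite signs of θ(t)−θ(t'), and the two forced strict inequalities add to 0 < 0; so Ψ is injective
into Γ^. [difficulty: M] [CohnUmans2003, GarsiaProcesi1992]
#9 TruncatedPolynomialVacuity (support) — why the route is equivariant: NON-equivariant hosting in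
truncated polynomial rings is equivalent to the summit — (∀ε ∃ N ≥ 2, M ≤ N^(2+ε): ⟨N,N,N⟩ is a
restriction of M-truncated univariate polynomial multiplication) ⇔ ω(ℂ) = 2. (→): T_M has an
order-(M−1) approximate decomposition with M terms (evaluate at ε·ζ^s, ζ a primitive M-th root of
unity), so bR(⟨N,N,N⟩) ≤ M and Bini (Blaser2013_thm66_holds). (←): ω = 2 ⇒ R(⟨N,N,N⟩) ≤ r =
N^(2+ε/2) eventually ⇒ ⟨N,N,N⟩ ≤ ⟨r⟩ (tensorRestrictsTo_unitTensor_of_tensorRank_le); a 3-AP-free B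
⊂ [0,L) with |B| ≥ r, L = r·e^(O(√log r)) (Mathlib roth_lower_bound) gives ⟨|B|⟩ ≤ T_(2L): x^b·x^b'
has x^(2c)-coefficient [b = b' = c]. The same argument in the Artin box of H^*(Fl_m) shows the
card's flag thesis without equivariance ⇔ ω = 2. [difficulty: provable-now] [Blaser2013,
BlaserLysikov2016, CohnUmans2003]
#9 ReesBound (support) — for a finite point set P ⊂ ℂ^d the orbit-harmonics ring ℂ[x]/LF(I(P)) has a
basis of size |P| and its structure tensor has border rank ≤ |P| (gr of the degree filtration on
Fun(P) ≅ ℂ^|P|; Rees family: structure constants c̃_ij^k = lim ε^(d_i+d_j−d_k) c_ij^k in a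
filtration-adapted basis; the easy half of Bläser–Lysikov "smoothable ⇒ minimal border rank").
[difficulty: M] [BlaserLysikov2016, GarsiaProcesi1992, Blaser2013]
#9 HostingRestriction (support) — a hosting identity γ(α(X)·β(Y)) = X·Y in any commutative ℂ-algebra
with a finite basis b exhibits ⟨N,N,N⟩ as a TensorRestrictsTo of structureTensor b (index
bookkeeping: output index first in both matMulTensor and structureTensor). [difficulty:
provable-now] [BurgisserClausenShokrollahi1997, Blaser2013]

TWO-LAYER PLAN. Foreseen once BeatAbelianBound closes positively: split FlagHosting along the
Wigner–Eckart reduction — FlagHosting ⇐ FullProductPairs (irreducible S_m-submodules L ≅ V_λ, L' ≅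
V_μ* of H^*(Fl_m) of dimension ≥ (m!)^(1/2−ε) whose product map L ⊗ L' → H^*(Fl_m) is injective) →
ReducedSystemSolvable (the reduced trilinear system on multiplicity spaces has a solution) →
FlagHosting. Once UniformObstruction closes instead: nothing to split (route refuted). The glue
FlagHosting → EquivariantOrbitHosting (ρ_V = permMatrixHom, rename σ = linear substitution) is
routine support, filed when FlagHosting moves.

KILL CRITERIA. UniformObstruction proved ⇒ close refuted:EquivariantOrbitHosting. A proof that ω = 2
already implies EquivariantOrbitHosting (vacuity of the equivariant form too) ⇒ close
superseded/known (the route would restate the target). Certified infeasibility of ALL N = 3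
instances (every group of order 17–26 with every faithful ρ_V and every (ρ_P,ρ_Q,ρ_R)) together with
S_5 (N ≤ 6) ⇒ ranks 2–3 dormant, pivot to GL_2(F_q)/Heisenberg hosts or close exhausted. Any
positive route proving ω = 2 moots the line (it only ever certifies ω = 2).

NOT DECOMPOSED YET. The Wigner–Eckart reformulation of FlagHosting (reduced structure maps M_λ ⊗ M_μ
→ M_ν of the coinvariant ring and their ranks) — needs Specht modules / isotypic projectors in Lean,
deferred; projective (Schur-multiplier) actions on M_N and union-of-few-orbits hosts — excluded from
the target on purpose (the abelian projective case dies by commutativity: φ(u)/φ(w) = ω^⟨u,w⟩ is not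
transitive); the laser-method use of T_(gr P) as an intermediate tensor (card item (3)) — a
different mechanism; the flag-specific vacuity (⟨N,N,N⟩ ≤ T_(H^*(Fl_m)) non-equivariantly ⇔ ω = 2,
via the Artin box ∏[0,⌈k/2⌉) and a Behrend sphere) — informal in the rationale, only the cyclic
version is filed.

CHEAPEST FALSIFIER. Decide the smallest non-abelian instance exactly: S_4 ↷ ℂ³, host H^*(Fl_4) (dim
24, basis x^a with a_k ≤ k−1), N = 3, (ρ_P,ρ_Q,ρ_R) ∈ {std, std⊗sgn}³ (and the reducible 3-dim
alternatives): by Schur the unknowns are 3·9 = 27 and the invariant trilinear equations |S_4|⁻¹Σ_g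
χ(g)⁶ = 744/24 = 31 — a Gröbner basis / exact ALS computation of minutes. Feasible ⇒
BeatAbelianBound PROVED (27 > 24) with an explicit certificate; infeasible for all sign choices ⇒
first data point for UniformObstruction; then SL(2,3) ↷ ℂ² (|Γ| = 24) and the order-18/20/21 groups.
Not run here (planner seat, hub compute-free); it is the refuters' first job (kit).

NUMBERS. bR(M_2) = 7; 17 ≤ bR(M_3) ≤ 20 (ConnerHarperLandsberg2023; Smirnov2013); bR(M_n) ≥ 2n² −
⌈log₂ n⌉ − 1 (LandsbergMichalek2018), so N = 4 needs |Γ| ≥ 29; bR(⟨6,6,6⟩) ≤ 140 = 20·7, so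
S_5-equivariant hosting of ⟨6,6,6⟩ in H^*(Fl_5) (dim 120, d_(3,1,1) = 6; 108 unknowns vs 397
invariant equations) would be a NEW border-rank bound; S_6, N = 16 = d_(3,2,1): bR(⟨16,16,16⟩) ≤ 720
would give ω ≤ log_16 720 = 2.3736 (record 2.3714); S_8, N = 90: log_90 8! = 2.357. Host Hilbert
series: H^*(Fl_m) = [m]_q!, max coefficient ≈ m!·6/(√(2π) m^1.5); d_max(S_m) = (m!)^(1/2)
e^(−O(√m)). Vacuity constants: Q(T_(ℂ[x]/(x^M))) ≥ roth(⌊M/2⌋) ≥ (M/2)e^(−4√log(M/2));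
Q(T_(H^*(Fl_m))) ≥ ((⌊m/2⌋)!)²/(m³/12+1).

DEFINITION REQUESTS. None filed: the orbit-harmonics ring is written inline
(MvPolynomial.vanishingIdeal, homogeneousComponent at totalDegree, Ideal.span) and equivariance is
stated upstairs in ℂ[x] (finite Γ, char 0: equivariant lifts exist by Maschke), so no quotient
action is needed. A reusable `Literature` definition of gr(P) / coinvariant rings with their
Γ-action (and Specht modules) would shorten every decl; wanted only if the route gains traction.

Novelty: Searches (2026-08-15; local searchd, galaxy, OpenAlex, S2 and arXiv were down or rate-limited
(connection reset / HTTP 429), zbMATH cascade used): lit search --source zbmath "orbit harmonics"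
(8: Garsia–Wallach 2003, Reineke–Rhoades–Tewari 2023 — combinatorics only) · "coinvariant algebra
matrix multiplication" (0 relevant) · "fast matrix multiplication symmetry group algorithm
invariant" (Burichenko arXiv:2211.03404) · "geometry of rank decompositions of matrix
multiplication" (arXiv:1801.00843, arXiv:1601.08229, arXiv:1610.08364, ConnerHarperLandsberg2023) ·
"group-theoretic approach fast matrix multiplication" (CohnUmans2003, CKSU2005, arXiv:1207.6528,
arXiv:2204.03826) · "smoothable algebra border rank tensor" (BlaserLysikov2016,
doi:10.1017/s0017089514000378, arXiv:2408.02754, arXiv:2103.12598) · "matrix multiplication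
restriction structure tensor commutative algebra" (0) · "matrix multiplication algorithms group
orbits Grochow Moore" (arXiv:1612.01527, arXiv:1708.09398); lit read arXiv:2410.14905 pp. 5, 13
(BCGPU 2024 host = convolution image on bounded-degree representative functions); the card's refuter
audit (arXiv:1606.04253, 1504.03732, 1601.08229, 2410.14905, 1207.6528).
Nearest prior art found: GrochowMoore2016 (arXiv:1612.01527) and Burichenko2022 (arXiv:2211.03404) —
group-invariant rank decompositions = equivariant hosting in the semisimple host ℂ^r; CohnUmans2003
/ BlasiakCohnGrochowPrattUmans2024 (arXiv:2410.14905) — TPP hosting in ℂ[G] and in degree-filtere  [refs: 10.1017/s0017089514000378, 2211.03404, 1801.00843, 1601.08229, 1610.08364, 1207.6528, 2204.03826, 2408.02754, 2103.12598, 1612.01527, 1708.09398, 2410.14905, 1606.04253, doi:10.1017/s0017089514000378, ConnerHarperLandsberg2023, CohnUmans2003, BlaserLysikov2016, GrochowMoore2016, Burichenko2022, BlasiakCohnGrochowPrattUmans2024, GarsiaProcesi1992]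

Barriers (technique_class: equivariant-smoothable-host, orbit-harmonics): - technique_class: equivariant-smoothable-host, orbit-harmonics
- Literature.Barriers.MatrixMultiplication.UnstableTensorBarrier: APPLIES to powers of a FIXED
unstable/minimal-border-rank algebra tensor (BlaserLysikov2020 Thm 16/17); evaded by construction —
one host gr(Γ_N·v) of growing dimension N^{2+o(1)} per N, used single-shot through bR(⟨N,N,N⟩) ≤
bR(T_host) ≤ |Γ_N| (evasions_known (i) "a sequence of tensors of increasing size"); no Kronecker
powers of a host are taken anywhere in the route.
- Literature.Barriers.MatrixMultiplication.IrreversibilityBarrier: bounds ω_T ≥ 2·i(T) for methods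
degenerating powers of an intermediate T; not this mechanism (restriction into a single host, no
intermediate powers). For the record the hosts are asymptotically reversible anyway: Q(T_{R_m}) ≥
(m!)^{1−o(1)} by the Behrend argument, so i(T_{R_m}) → 1.
- Literature.Barriers.MatrixMultiplication.UniversalMethodBarrier: same scope as Irreversibility
(universal method on powers of a fixed tensor); not used.
- Literature.Barriers.MatrixMultiplication.TricoloredSumFreeBarrier: slice rank of abelian
bounded-exponent group algebras; the host here is the commutative orbit-harmonics ring whose tensor
has near-full slice rank/subrank (Behrend), so the slice-rank mechanism certifies nothing against
it. What transfers is the abelian no-go: as |S||T||U| ≤ |G| for abelian TPP, AbelianNoGo (support)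
gives N³ ≤ |Γ| for abelian Γ; the bet is explicitly non-abelian (BeatAbelianBound), and a refuter
exte

Novelty grade: new-combination — ROUTE REVIEW (refuter 2026-08-15). new-combination = equivariant TPP-style hosting of ⟨N,N,N⟩ in an algebra carrying the regular Γ-module (Cohn–Umans 2003; commutative hosts via coherent configurations, CU2013 arXiv:1207.6528) × minimal-border-rank smoothable hosts gr(Γ·v) (Bläser–Lysikov 2016, Gars (refuter refuter-rreview-route-KontsevichZagierPe-26fef624-0, 2026-08-15T14:16:38Z; prior: CohnUmans2003, arXiv:1207.6528 (Cohn–Umans 2013, coherent configurations: commutative adjacency-algebra hosts), BlaserLysikov2016 (smoothable algebras / minimal border rank structure tensors), GarsiaProcesi1992 (orbit harmonics, graded regular module), GrochowMoore2016, Burichenko2022 (arXiv:2211.03404), BlasiakCohnGrochowPrattUmans2024 (arXiv:2410.14905))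

History (route lifecycle, newest last):
- 2026-08-16T04:11:06Z · AUTO-CRUX (backfill): EquivariantOrbitHosting — hypotheses of the deciding theorem that nothing in the route derives are cruxes (operator:999:1085951)
- 2026-08-22T04:25:32Z · DORMANT — reconciler: no traction for 5.1 d (last activity item-evidence-added at 2026-08-17T02:21:36Z); parked, not closed — `ledger route dormant route-MatrixMultiplica (operator:999:3124435)

sub-problem: MatrixMultiplication · status: dormant · opened planner-plancard-MatrixMultiplication-MatrixM-ab1e580d-0 2026-08-15T11:41:14Z · rev 1 · ledger route-MatrixMultiplication-OrbitHarmonicsHosts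
GENERATED by the gate from the ledger (D-0016/17). Provers cite these decls: `theorem foo : Summit.MatrixMultiplication.MatrixMultiplication.Theses.OrbitHarmonicsHosts.<Decl> := …` in Summits/MatrixMultiplication/MatrixMultiplication/Theorems/<Name>.lean.
-/

namespace Summit.MatrixMultiplication.MatrixMultiplication.Theses.OrbitHarmonicsHosts

open scoped BigOperators Topology Manifold Classical MeasureTheory ProbabilityTheory Matrix InnerProductSpace ComplexConjugate ContinuousMap
open Filter Set Function TopologicalSpace MeasureTheory

attribute [summit_statement] _root_.MatrixMultiplication

/-- item stmt-MatrixMultiplication-5452 · crux (kind.auto-crux: conjecture-grade) · rank 0 · open · by planner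
why it might fail: commutativity + grading + Wigner–Eckart may force N^(2+c) ≤ |Γ| for all Γ (UniformObstruction); no instance beating even the abelian bound N³ ≤ |Γ| is known.
sources: BlaserLysikov2016, GarsiaProcesi1992, CohnUmans2003, GrochowMoore2016
[target] X_OH as in § Thesis (general finite Γ, free orbit, equivariant hosting with |Γ| ≤ N^(2+ε)
for every ε > 0). -/
@[route_item "route-MatrixMultiplication-OrbitHarmonicsHosts", crux]
def EquivariantOrbitHosting : Prop :=
  ∀ ε : ℝ, 0 < ε → ∃ (Γ : Type) (_ : Group Γ) (_ : Fintype Γ) (d N : ℕ) (ρV : Γ →* GL (Fin d) ℂ) (v : Fin d → ℂ) (ρP ρQ ρR : Γ →* GL (Fin N) ℂ) (α β : Matrix (Fin N) (Fin N) ℂ →ₗ[ℂ] MvPolynomial (Fin d) ℂ) (γ : MvPolynomial (Fin d) ℂ →ₗ[ℂ] Matrix (Fin N) (Fin N) ℂ), 2 ≤ N ∧ (Fintype.card Γ : ℝ) ≤ (N : ℝ) ^ (2 + ε) ∧ Function.Injective (fun g : Γ => (ρV g : Matrix (Fin d) (Fin d) ℂ).mulVec v) ∧ (∀ f ∈ Ideal.span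 ((fun f : MvPolynomial (Fin d) ℂ => MvPolynomial.homogeneousComponent f.totalDegree f) '' ((MvPolynomial.vanishingIdeal ℂ (Set.range fun g : Γ => (ρV g : Matrix (Fin d) (Fin d) ℂ).mulVec v) : Ideal (MvPolynomial (Fin d) ℂ)) : Set (MvPolynomial (Fin d) ℂ))), γ f = 0) ∧ (∀ X Y, γ (α X * β Y) = X * Y) ∧ (∀ (g : Γ) (X : Matrix (Fin N) (Fin N) ℂ), α ((ρP g⁻¹ : Matrix (Fin N) (Fin N) ℂ) * X * (ρQ g : Matrix (Fin N) (Fin N) ℂ)) = MvPolynomial.aeval (fun i : Fin d => ∑ j : Fin d, (ρV g : Matrix (Fin d) (Fin d) ℂ) i j • (MvPolynomial.X j : MvPolynomial (Fin d) ℂ)) (α X)) ∧ (∀ (g : Γ) (Y : Matrix (Fin N) (Fin N) ℂ), β ((ρQ g⁻¹ : Matrix (Fin N) (Fin N) ℂ) * Y * (ρR g : Matrix (Fin N) (Fin N) ℂ)) = MvPolynomial.aeval (fun i : Fin d => ∑ j : Fin d, (ρV g : Matrix (Fin d) (Fin d) ℂ) i j • (MvPolynomial.X j : MvPolynomial (Fin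 d) ℂ)) (β Y)) ∧ (∀ (g : Γ) (f : MvPolynomial (Fin d) ℂ), γ (MvPolynomial.aeval (fun i : Fin d => ∑ j : Fin d, (ρV g : Matrix (Fin d) (Fin d) ℂ) i j • (MvPolynomial.X j : MvPolynomial (Fin d) ℂ)) (f)) = (ρP g⁻¹ : Matrix (Fin N) (Fin N) ℂ) * γ f * (ρR g : Matrix (Fin N) (Fin N) ℂ))

/-- item stmt-MatrixMultiplication-5453 · crux · rank 2 · open · by planner
why it might fail: Wigner–Eckart reduces it to reduced cup-product maps between fake-degree multiplicity spaces M_λ ⊗ M_μ → M_ν of H^*(Fl_m), which may have far too little rank; nothing is known even at m = 4 (⟨3,3,3⟩, 27 unknowns / 31 equations).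
sources: GarsiaProcesi1992, BlaserLysikov2016, CohnUmans2003, Burichenko2022
[crux] the flag family realises X_OH: for every ε > 0 some coinvariant ring H^*(Fl_m) =
gr(S_m·(0,1,…,m−1)) hosts ⟨N,N,N⟩ S_m-equivariantly (ρ_P, ρ_Q, ρ_R : S_m → GL_N, α, β, γ
intertwining rename σ) with m! ≤ N^(2+ε) (card orbit-harmonics-hosts "flag-cohomology conjecture";
d_max(S_m) = (m!)^(1/2−o(1)) makes the count possible). [difficulty: open-problem] -/
@[route_item "route-MatrixMultiplication-OrbitHarmonicsHosts"]
def FlagHosting : Prop :=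
  ∀ ε : ℝ, 0 < ε → ∃ (m N : ℕ) (ρP ρQ ρR : Equiv.Perm (Fin m) →* GL (Fin N) ℂ) (α β : Matrix (Fin N) (Fin N) ℂ →ₗ[ℂ] MvPolynomial (Fin m) ℂ) (γ : MvPolynomial (Fin m) ℂ →ₗ[ℂ] Matrix (Fin N) (Fin N) ℂ), 2 ≤ N ∧ (m.factorial : ℝ) ≤ (N : ℝ) ^ (2 + ε) ∧ (∀ f ∈ Ideal.span ((fun f : MvPolynomial (Fin m) ℂ => MvPolynomial.homogeneousComponent f.totalDegree f) '' ((MvPolynomial.vanishingIdeal ℂ (Set.range fun σ : Equiv.Perm (Fin m) => fun i : Fin m => ((σ i : ℕ) : ℂ)) : Ideal (MvPolynomial (Fin m) ℂ)) : Set (MvPolynomial (Fin m) ℂ))), γ f = 0) ∧ (∀ X Y, γ (α X * β Y) = X * Y) ∧ (∀ (σ : Equiv.Perm (Fin m)) (X : Matrix (Fin N) (Fin N) ℂ), α ((ρP σ : Matrix (Fin N) (Fin N) ℂ) * X * (ρQ σ⁻¹ : Matrix (Fin N) (Fin N) ℂ)) = MvPolynomial.rename σ (α X)) ∧ (∀ (σ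 : Equiv.Perm (Fin m)) (Y : Matrix (Fin N) (Fin N) ℂ), β ((ρQ σ : Matrix (Fin N) (Fin N) ℂ) * Y * (ρR σ⁻¹ : Matrix (Fin N) (Fin N) ℂ)) = MvPolynomial.rename σ (β Y)) ∧ (∀ (σ : Equiv.Perm (Fin m)) (f : MvPolynomial (Fin m) ℂ), γ (MvPolynomial.rename σ f) = (ρP σ : Matrix (Fin N) (Fin N) ℂ) * γ f * (ρR σ⁻¹ : Matrix (Fin N) (Fin N) ℂ))

/-- item stmt-MatrixMultiplication-5454 · crux · rank 3 · open · by planner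
why it might fail: the S_4 / order-≤26 systems (e.g. 27 unknowns vs 31 invariant trilinear equations for S_4, std⊗std⊗std) may all be infeasible; commutativity may force N³ ≤ |Γ| for every Γ, not only abelian ones.
sources: CohnUmans2003, ConnerHarperLandsberg2023, Smirnov2013, GrochowMoore2016
[crux] SOME finite Γ (necessarily non-abelian, by AbelianNoGo) hosts ⟨N,N,N⟩ equivariantly in
gr(Γ·v) with N³ > |Γ| — the analogue of the first Cohn–Umans groups beating the trivial bound;
necessary for X_OH (ε < 1); a finite search: N = 3 needs |Γ| ∈ [17,26] (bR(M_3) ≥ 17), e.g. S_4 ↷ ℂ³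
(host H^*(Fl_4), Hilbert series 1,3,5,6,5,3,1) or SL(2,3) ↷ ℂ²; N = 4 needs |Γ| ∈ [29,63] (GL(2,3),
A_5 ⊂ SO_3, …). [difficulty: M] -/
@[route_item "route-MatrixMultiplication-OrbitHarmonicsHosts"]
def BeatAbelianBound : Prop :=
  ∃ (Γ : Type) (_ : Group Γ) (_ : Fintype Γ) (d N : ℕ) (ρV : Γ →* GL (Fin d) ℂ) (v : Fin d → ℂ) (ρP ρQ ρR : Γ →* GL (Fin N) ℂ) (α β : Matrix (Fin N) (Fin N) ℂ →ₗ[ℂ] MvPolynomial (Fin d) ℂ) (γ : MvPolynomial (Fin d) ℂ →ₗ[ℂ] Matrix (Fin N) (Fin N) ℂ), Fintype.card Γ < N ^ 3 ∧ Function.Injective (fun g : Γ => (ρV g : Matrix (Fin d) (Fin d) ℂ).mulVec v) ∧ (∀ f ∈ Ideal.span ((fun f : MvPolynomial (Fin d) ℂ => MvPolynomial.homogeneousComponent f.totalDegree f) '' ((MvPolynomial.vanishingIdeal ℂ (Set.range fun g : Γ => (ρV g : Matrix (Fin d) (Fin d) ℂ).mulVec v) : Ideal (MvPolynomial (Fin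 d) ℂ)) : Set (MvPolynomial (Fin d) ℂ))), γ f = 0) ∧ (∀ X Y, γ (α X * β Y) = X * Y) ∧ (∀ (g : Γ) (X : Matrix (Fin N) (Fin N) ℂ), α ((ρP g⁻¹ : Matrix (Fin N) (Fin N) ℂ) * X * (ρQ g : Matrix (Fin N) (Fin N) ℂ)) = MvPolynomial.aeval (fun i : Fin d => ∑ j : Fin d, (ρV g : Matrix (Fin d) (Fin d) ℂ) i j • (MvPolynomial.X j : MvPolynomial (Fin d) ℂ)) (α X)) ∧ (∀ (g : Γ) (Y : Matrix (Fin N) (Fin N) ℂ), β ((ρQ g⁻¹ : Matrix (Fin N) (Fin N) ℂ) * Y * (ρR g : Matrix (Fin N) (Fin N) ℂ)) = MvPolynomial.aeval (fun i : Fin d => ∑ j : Fin d, (ρV g : Matrix (Fin d) (Fin d) ℂ) i j • (MvPolynomial.X j : MvPolynomial (Fin d) ℂ)) (β Y)) ∧ (∀ (g : Γ) (f : MvPolynomial (Fin d) ℂ), γ (MvPolynomial.aeval (fun i : Fin d => ∑ j : Fin d, (ρV g : Matrix (Fin d) (Fin d) ℂ) i j • (MvPolynomial.X j : MvPolynomial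 (Fin d) ℂ)) (f)) = (ρP g⁻¹ : Matrix (Fin N) (Fin N) ℂ) * γ f * (ρR g : Matrix (Fin N) (Fin N) ℂ))

/-- item stmt-MatrixMultiplication-5455 · crux · rank 4 · open · by planner
why it might fail: non-abelian Γ with d_λ = |Γ|^(1/2−o(1)) (S_m, GL_2(F_q)) may genuinely host at N = |Γ|^(1/2−o(1)); the gap may exist but be non-uniform in Γ.
sources: CohnUmans2003, BlaserLysikov2020, BlasiakCohnGrochowPrattUmans2023
[crux] NEGATIVE side, refuter-facing: there is c > 0 (and C) such that every Γ-equivariant hosting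
of ⟨N,N,N⟩ in an orbit-harmonics ring gr(Γ·v) (free orbit) has N^(2+c) ≤ C·|Γ|; proving it refutes
EquivariantOrbitHosting and closes the route. Natural tools: gr = ⊕ V_λ ⊗ M_λ with M_λ graded by
fake degrees, gr(P)^Γ = ℂ (transitivity), socle/degree filtration, the abelian injectivity argument.
[difficulty: L] -/
@[route_item "route-MatrixMultiplication-OrbitHarmonicsHosts"]
def UniformObstruction : Prop :=
  ∃ c : ℝ, 0 < c ∧ ∃ C : ℝ, ∀ (Γ : Type) [Group Γ] [Fintype Γ] (d N : ℕ) (ρV : Γ →* GL (Fin d) ℂ) (v : Fin d → ℂ) (ρP ρQ ρR : Γ →* GL (Fin N) ℂ) (α β : Matrix (Fin N) (Fin N) ℂ →ₗ[ℂ] MvPolynomial (Fin d) ℂ) (γ : MvPolynomial (Fin d) ℂ →ₗ[ℂ] Matrix (Fin N) (Fin N) ℂ), Function.Injective (fun g : Γ => (ρV g : Matrix (Fin d) (Fin d) ℂ).mulVec v) → (∀ f ∈ Ideal.span ((fun f : MvPolynomial (Fin d) ℂ => MvPolynomial.homogeneousComponent f.totalDegree f) '' ((MvPolynomial.vanishingIdeal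 ℂ (Set.range fun g : Γ => (ρV g : Matrix (Fin d) (Fin d) ℂ).mulVec v) : Ideal (MvPolynomial (Fin d) ℂ)) : Set (MvPolynomial (Fin d) ℂ))), γ f = 0) → (∀ X Y, γ (α X * β Y) = X * Y) → (∀ (g : Γ) (X : Matrix (Fin N) (Fin N) ℂ), α ((ρP g⁻¹ : Matrix (Fin N) (Fin N) ℂ) * X * (ρQ g : Matrix (Fin N) (Fin N) ℂ)) = MvPolynomial.aeval (fun i : Fin d => ∑ j : Fin d, (ρV g : Matrix (Fin d) (Fin d) ℂ) i j • (MvPolynomial.X j : MvPolynomial (Fin d) ℂ)) (α X)) → (∀ (g : Γ) (Y : Matrix (Fin N) (Fin N) ℂ), β ((ρQ g⁻¹ : Matrix (Fin N) (Fin N) ℂ) * Y * (ρR g : Matrix (Fin N) (Fin N) ℂ)) = MvPolynomial.aeval (fun i : Fin d => ∑ j : Fin d, (ρV g : Matrix (Fin d) (Fin d) ℂ) i j • (MvPolynomial.X j : MvPolynomial (Fin d) ℂ)) (β Y)) → (∀ (g : Γ) (f : MvPolynomial (Fin d) ℂ), γ (MvPolynomial.aeval (fun i : Fin d => ∑ j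 : Fin d, (ρV g : Matrix (Fin d) (Fin d) ℂ) i j • (MvPolynomial.X j : MvPolynomial (Fin d) ℂ)) (f)) = (ρP g⁻¹ : Matrix (Fin N) (Fin N) ℂ) * γ f * (ρR g : Matrix (Fin N) (Fin N) ℂ)) → (N : ℝ) ^ (2 + c) ≤ C * Fintype.card Γ

/-- item stmt-MatrixMultiplication-5456 · support · rank 9 · closed · proved by Summit.MatrixMultiplication.MatrixMultiplication.Theorems.AbelianNoGo_proof @ 9860e8d0d157 (prover) · by planner
sources: CohnUmans2003, GarsiaProcesi1992
[support] abelian symmetry gives nothing: for commutative Γ every equivariant hosting in gr(Γ·v) has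
N³ ≤ |Γ|. Proof sketch: gr ≅ regular module with 1-dim weight spaces f_χ in single degrees ℓ(χ), f_χ
f_ψ ≠ 0 iff ℓ(χ+ψ) = ℓ(χ)+ℓ(ψ); equivariance makes α, β, γ monomial (X_st ↦ f_(p_s−q_t), …); matched
products nonzero ⇒ levels a(s,t)+b(t,u) = c(s,u) ⇒ a = a₀(s)+θ(t), b = b₀(u)−θ(t); a collision of
Ψ(s,t,u) = p_s − r_u + q_t with t ≠ t' is a cross term read twice with opposite signs of θ(t)−θ(t'),
and the two forced strict inequalities add to 0 < 0; so Ψ is injective into Γ^. [difficulty: M] -/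
@[route_item "route-MatrixMultiplication-OrbitHarmonicsHosts"]
def AbelianNoGo : Prop :=
  ∀ (Γ : Type) [CommGroup Γ] [Fintype Γ] (d N : ℕ) (ρV : Γ →* GL (Fin d) ℂ) (v : Fin d → ℂ) (ρP ρQ ρR : Γ →* GL (Fin N) ℂ) (α β : Matrix (Fin N) (Fin N) ℂ →ₗ[ℂ] MvPolynomial (Fin d) ℂ) (γ : MvPolynomial (Fin d) ℂ →ₗ[ℂ] Matrix (Fin N) (Fin N) ℂ), Function.Injective (fun g : Γ => (ρV g : Matrix (Fin d) (Fin d) ℂ).mulVec v) → (∀ f ∈ Ideal.span ((fun f : MvPolynomial (Fin d) ℂ => MvPolynomial.homogeneousComponent f.totalDegree f) '' ((MvPolynomial.vanishingIdeal ℂ (Set.range fun g : Γ => (ρV g : Matrix (Fin d) (Fin d) ℂ).mulVec v) : Ideal (MvPolynomial (Fin d) ℂ)) : Set (MvPolynomial (Fin d) ℂ))), γ f = 0) → (∀ X Y, γ (α X * β Y) = X * Y) → (∀ (g : Γ) (X : Matrix (Fin N) (Fin N) ℂ), α ((ρP g⁻¹ : Matrix (Fin N) (Fin N) ℂ) * X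 * (ρQ g : Matrix (Fin N) (Fin N) ℂ)) = MvPolynomial.aeval (fun i : Fin d => ∑ j : Fin d, (ρV g : Matrix (Fin d) (Fin d) ℂ) i j • (MvPolynomial.X j : MvPolynomial (Fin d) ℂ)) (α X)) → (∀ (g : Γ) (Y : Matrix (Fin N) (Fin N) ℂ), β ((ρQ g⁻¹ : Matrix (Fin N) (Fin N) ℂ) * Y * (ρR g : Matrix (Fin N) (Fin N) ℂ)) = MvPolynomial.aeval (fun i : Fin d => ∑ j : Fin d, (ρV g : Matrix (Fin d) (Fin d) ℂ) i j • (MvPolynomial.X j : MvPolynomial (Fin d) ℂ)) (β Y)) → (∀ (g : Γ) (f : MvPolynomial (Fin d) ℂ), γ (MvPolynomial.aeval (fun i : Fin d => ∑ j : Fin d, (ρV g : Matrix (Fin d) (Fin d) ℂ) i j • (MvPolynomial.X j : MvPolynomial (Fin d) ℂ)) (f)) = (ρP g⁻¹ : Matrix (Fin N) (Fin N) ℂ) * γ f * (ρR g : Matrix (Fin N) (Fin N) ℂ)) → N ^ 3 ≤ Fintype.card Γ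

/-- item stmt-MatrixMultiplication-5457 · support · rank 9 · closed · proved by Summit.MatrixMultiplication.MatrixMultiplication.Theorems.truncatedPolynomialVacuity_proof @ b221eae22c77 (prover) · by planner
sources: Blaser2013, BlaserLysikov2016, CohnUmans2003
[support] why the route is equivariant: NON-equivariant hosting in truncated polynomial rings is
equivalent to the summit — (∀ε ∃ N ≥ 2, M ≤ N^(2+ε): ⟨N,N,N⟩ is a restriction of M-truncated
univariate polynomial multiplication) ⇔ ω(ℂ) = 2. (→): T_M has an order-(M−1) approximate
decomposition with M terms (evaluate at ε·ζ^s, ζ a primitive M-th root of unity), so bR(⟨N,N,N⟩) ≤ M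
and Bini (Blaser2013_thm66_holds). (←): ω = 2 ⇒ R(⟨N,N,N⟩) ≤ r = N^(2+ε/2) eventually ⇒ ⟨N,N,N⟩ ≤
⟨r⟩ (tensorRestrictsTo_unitTensor_of_tensorRank_le); a 3-AP-free B ⊂ [0,L) with |B| ≥ r, L =
r·e^(O(√log r)) (Mathlib roth_lower_bound) gives ⟨|B|⟩ ≤ T_(2L): x^b·x^b' has x^(2c)-coefficient [b
= b' = c]. The same argument in the Artin box of H^*(Fl_m) shows the card's flag thesis without
equivariance ⇔ ω = 2. [difficulty: provable-now] -/
@[route_item "route-MatrixMultiplication-OrbitHarmonicsHosts"]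
def TruncatedPolynomialVacuity : Prop :=
  (∀ ε : ℝ, 0 < ε → ∃ N M : ℕ, 2 ≤ N ∧ (M : ℝ) ≤ (N : ℝ) ^ (2 + ε) ∧ Literature.Computability.AlgebraicComplexity.TensorRestrictsTo (fun k i j : Fin M => if (i : ℕ) + j = k then (1 : ℂ) else 0) (Literature.Computability.AlgebraicComplexity.matMulTensor ℂ N N N)) ↔ MatrixMultiplication

/-- item stmt-MatrixMultiplication-5458 · support · rank 9 · closed · proved by Summit.MatrixMultiplication.MatrixMultiplication.Theorems.reesBound_proof @ 29fd5be61453 (prover) · by planner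
sources: BlaserLysikov2016, GarsiaProcesi1992, Blaser2013
[support] for a finite point set P ⊂ ℂ^d the orbit-harmonics ring ℂ[x]/LF(I(P)) has a basis of size
|P| and its structure tensor has border rank ≤ |P| (gr of the degree filtration on Fun(P) ≅ ℂ^|P|;
Rees family: structure constants c̃_ij^k = lim ε^(d_i+d_j−d_k) c_ij^k in a filtration-adapted basis;
the easy half of Bläser–Lysikov "smoothable ⇒ minimal border rank"). [difficulty: M] -/
@[route_item "route-MatrixMultiplication-OrbitHarmonicsHosts", crux]
def ReesBound : Prop :=
  ∀ (d : ℕ) (P : Finset (Fin d → ℂ)), ∃ b : Module.Basis (Fin P.card) ℂ (MvPolynomial (Fin d) ℂ ⧸ Ideal.span ((fun f : MvPolynomial (Fin d) ℂ => MvPolynomial.homogeneousComponent f.totalDegree f) '' ((MvPolynomial.vanishingIdeal ℂ (P : Set (Fin d → ℂ)) : Ideal (MvPolynomial (Fin d) ℂ)) : Set (MvPolynomial (Fin d) ℂ)))), Literature.Computability.AlgebraicComplexity.algBorderRank (Literature.Computability.AlgebraicComplexity.structureTensor b) ≤ P.card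

/-- item stmt-MatrixMultiplication-5459 · support · rank 9 · closed · proved by Summit.MatrixMultiplication.MatrixMultiplication.Theorems.hostingRestriction_proof @ 5270a6c39a52 (prover) · by planner
sources: BurgisserClausenShokrollahi1997, Blaser2013
[support] a hosting identity γ(α(X)·β(Y)) = X·Y in any commutative ℂ-algebra with a finite basis b
exhibits ⟨N,N,N⟩ as a TensorRestrictsTo of structureTensor b (index bookkeeping: output index first
in both matMulTensor and structureTensor). [difficulty: provable-now] -/
@[route_item "route-MatrixMultiplication-OrbitHarmonicsHosts", crux]
def HostingRestriction : Prop :=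
  ∀ (A : Type) [CommRing A] [Algebra ℂ A] (ι : Type) [Fintype ι] (b : Module.Basis ι ℂ A) (N : ℕ) (α β : Matrix (Fin N) (Fin N) ℂ →ₗ[ℂ] A) (γ : A →ₗ[ℂ] Matrix (Fin N) (Fin N) ℂ), (∀ X Y, γ (α X * β Y) = X * Y) → Literature.Computability.AlgebraicComplexity.TensorRestrictsTo (Literature.Computability.AlgebraicComplexity.structureTensor b) (Literature.Computability.AlgebraicComplexity.matMulTensor ℂ N N N)

/-- item stmt-MatrixMultiplication-5460 · assembly · rank 1 · closed · proved by Summit.MatrixMultiplication.MatrixMultiplication.Theorems.orbitHarmonicsHosts_assembly_proof @ 260a17bbe4c1 (prover) · by planner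
sources: Blaser2013, BlaserLysikov2016
[assembly] EquivariantOrbitHosting → MatrixMultiplication (via HostingRestriction, ReesBound,
border-rank monotonicity under restriction, Bini's theorem). -/
@[route_item "route-MatrixMultiplication-OrbitHarmonicsHosts"]
def Assembly : Prop :=
  EquivariantOrbitHosting → MatrixMultiplication

/-! D-0027 §2.1 — DECIDING THEOREM (planner-authored via `route open/edit --closes-file`; by planner-rbadge-MatrixMultiplication-OrbitHarmo-2afe0db8-g2-0 2026-08-15T16:20:08Z):
its hypotheses are this route's items and its conclusion the sub-problem Statement (glue_lint), and it elaborates with this file. -/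

/-- DECIDING THEOREM (D-0027 §2.1). From `EquivariantOrbitHosting` at `ε > 0` take the finite group
`Γ`, the free orbit `P = Γ·v ⊂ ℂ^d` (a point set of size `|Γ|`) and the hosting maps `α, β, γ`
(the equivariance conjuncts are not needed here); push `α, β` down to the orbit-harmonics ring
`A = ℂ[x]/LF(I(P))` along the quotient map and factor `γ` through it (`γ` kills the ideal), so that
`HostingRestriction`, applied with the basis of `A` provided by `ReesBound`, exhibits `⟨N,N,N⟩` as a
restriction of the structure tensor of `A`; border rank is monotone under restriction
(`TensorRestrictsTo.algBorderRank_le`) and `ReesBound` bounds the host's border rank by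
`|P| = |Γ| ≤ N^(2+ε)`, so Bini's theorem (`Blaser2013_thm66_holds.cubic`, proved in tree, `N ≥ 2`)
gives `ω(ℂ) ≤ log_N |Γ| ≤ 2 + ε` for every `ε > 0`; with `omega_two_le ℂ` this is `ω(ℂ) = 2`,
i.e. `MatrixMultiplication`. -/
@[closes "route-MatrixMultiplication-OrbitHarmonicsHosts"] theorem closes (hX : EquivariantOrbitHosting) (hH : HostingRestriction) (hR : ReesBound) :
    MatrixMultiplication := by
  classical
  show Literature.Computability.AlgebraicComplexity.omega ℂ = 2
  refine le_antisymm ?_ (Literature.Computability.AlgebraicComplexity.omega_two_le ℂ)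
  refine le_of_forall_pos_le_add fun ε hε => ?_
  obtain ⟨Γ, _instG, _instF, d, N, ρV, v, ρP, ρQ, ρR, α, β, γ, hN, hcard, hinj, hγ, hhost, -, -, -⟩ :=
    hX ε hε
  -- (1) a hosting identity in `ℂ[x]` whose `γ` kills an ideal `J` descends to the quotient `ℂ[x]/J`,
  --     where `HostingRestriction` turns it into a restriction of the structure tensor
  have core : ∀ (J : Ideal (MvPolynomial (Fin d) ℂ)) (n : ℕ)
      (b : Module.Basis (Fin n) ℂ (MvPolynomial (Fin d) ℂ ⧸ J)), (∀ f ∈ J, γ f = 0) →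
      Literature.Computability.AlgebraicComplexity.TensorRestrictsTo
        (Literature.Computability.AlgebraicComplexity.structureTensor b)
        (Literature.Computability.AlgebraicComplexity.matMulTensor ℂ N N N) := by
    intro J n b hJ
    have hle : J.restrictScalars ℂ ≤ LinearMap.ker γ := by
      intro f hf
      exact LinearMap.mem_ker.2 (hJ f hf)
    refine hH (MvPolynomial (Fin d) ℂ ⧸ J) (Fin n) b N
      ((Ideal.Quotient.mkₐ ℂ J).toLinearMap ∘ₗ α) ((Ideal.Quotient.mkₐ ℂ J).toLinearMap ∘ₗ β)
      ((J.restrictScalars ℂ).liftQ γ hle ∘ₗ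
        (Submodule.Quotient.restrictScalarsEquiv ℂ J).symm.toLinearMap) ?_
    intro X Y
    refine (congrArg ((J.restrictScalars ℂ).liftQ γ hle ∘ₗ
        (Submodule.Quotient.restrictScalarsEquiv ℂ J).symm.toLinearMap)
      (map_mul (Ideal.Quotient.mkₐ ℂ J) (α X) (β Y)).symm).trans ?_
    -- `liftQ` and `restrictScalarsEquiv.symm` compute on representatives: this is `γ (α X * β Y)`
    exact hhost X Y
  -- (2) the free orbit as a finite point set of size `|Γ|`
  set F : Γ → (Fin d → ℂ) := fun g => (ρV g : Matrix (Fin d) (Fin d) ℂ).mulVec v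
  have hPcard : (Finset.univ.image F).card = Fintype.card Γ := by
    rw [Finset.card_image_of_injective _ hinj, Finset.card_univ]
  have hPset : ((Finset.univ.image F : Finset (Fin d → ℂ)) : Set (Fin d → ℂ)) = Set.range F := by
    rw [Finset.coe_image, Finset.coe_univ, Set.image_univ]
  -- (3) the orbit-harmonics host: basis and border-rank bound (`ReesBound`), then the restriction
  have hR' := hR d (Finset.univ.image F)
  rw [hPset] at hR'
  obtain ⟨b, hb⟩ := hR'
  have hres := core _ _ b hγ
  have hbr : Literature.Computability.AlgebraicComplexity.algBorderRank
      (Literature.Computability.AlgebraicComplexity.matMulTensor ℂ N N N) ≤ Fintype.card Γ :=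
    hres.algBorderRank_le.trans (hb.trans hPcard.le)
  -- (4) Bini's theorem and `log_N |Γ| ≤ 2 + ε`
  have hr1 : 1 ≤ Fintype.card Γ := Fintype.card_pos
  have hω : Literature.Computability.AlgebraicComplexity.omega ℂ ≤ Real.logb N (Fintype.card Γ) :=
    Literature.Computability.AlgebraicComplexity.Blaser2013_thm66_holds.cubic ℂ hN hr1 hbr
  have hN1 : (1 : ℝ) < N := by exact_mod_cast (lt_of_lt_of_le (by norm_num) hN)
  have hrpos : (0 : ℝ) < Fintype.card Γ := by exact_mod_cast hr1
  calc Literature.Computability.AlgebraicComplexity.omega ℂ ≤ Real.logb N (Fintype.card Γ) := hω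
    _ ≤ Real.logb N ((N : ℝ) ^ (2 + ε)) := Real.logb_le_logb_of_le hN1 hrpos hcard
    _ = 2 + ε := Real.logb_rpow (by linarith) (ne_of_gt hN1)

end Summit.MatrixMultiplication.MatrixMultiplication.Theses.OrbitHarmonicsHosts
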